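import Mathlib.GroupTheory.CoprodI
import Mathlib.GroupTheory.SemidirectProduct
import Mathlib.GroupTheory.FreeGroup.CyclicallyReduced
import Mathlib.GroupTheory.Index
import Mathlib.Data.ZMod.Basic
import Mathlib.Data.Fin.VecNotation
import HarnessLib

/-!
# The free product `ℤ/2 ∗ ℤ/2 ∗ ℤ/2` has exactly one torsion-free subgroup of index two
# ([AbsTopII] Rmk 3.1.1 / [AbsTopIII] Cor. 2.7 (a): «the unique torsion-free subgroup of index two of the group Π»)

Topic `GroupTheory/CombinatorialGroupTheory`; namespace `Literature.GroupTheory.CombinatorialGroupTheory`. Cell `abc-iut`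
(seat abc-iut-w5-d104, D-0068 full-M discharge), sub-node **Cor-27.a.r2 (a).1** of abc-iut-L4-t12's sub-DAG
`plan/L4/SUBDAG-AbsTopIII-Cor-27.md` for [AbsTopIII] Corollary 2.7: the typed sub-node
`Literature.AnabelianGeometry.AbsoluteAnabelian.HolomorphicEllipticCuspidalization.IndexTwoTorsionFreeUnique`
(p414370, review lane) is VERBATIM the statement `existsUnique_index_two_torsionFree` below, so the closing
`_holds` theorem is a one-line corollary once that module builds. THEOREMS ONLY (Mathlib-only; no `def`, no named
fact, no instance, no notation).

## Sources

[MochizukiAbsTopIII2015] S. Mochizuki, *Topics in Absolute Anabelian Geometry III*, Cor. 2.7 (a) p.58: «the unique [cf.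
[Mzk21], Remark 3.1.1] double covering 𝔼 → ℍ … [i.e., the covering determined by the unique torsion-free subgroup of
index two of the group Π of Corollary 2.4, (c)]» — `Π = π₁^orb` of the semi-elliptic core of type `(0; 2, 2, 2; ∞)` is
the free product of three groups of order two. The group theory is classical (e.g. Lyndon–Schupp, *Combinatorial
Group Theory*, IV.1: torsion elements of a free product are conjugate into a factor); we AVOID the normal-form
argument by an explicit isomorphism onto `F₂ ⋊ ℤ/2`.

## Proof (what is kernel-checked here)

Let `G = C₂ ∗ C₂ ∗ C₂` with factor generators `a, b, c`, `F₂` free on `x, y`, and `τ` the involution of `F₂`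
inverting both generators. Universal properties give `ψ : G → F₂ ⋊ ⟨τ⟩`, `a ↦ τ`, `b ↦ xτ`, `c ↦ yτ` (three
involutions) and `Θ : F₂ ⋊ ⟨τ⟩ → G`, `x ↦ ba`, `y ↦ ca`, `τ ↦ a`, with `Θ ∘ ψ = id` (check on `a, b, c`), so `ψ` is
injective. EXISTENCE: the kernel `K` of the sign homomorphism `Φ : G → C₂` (identity on each factor) has index `2`
(`Φ` is onto) and is torsion-free: `ψ(K) ⊆ F₂ × 1` (`rightHom ∘ ψ = Φ`) and free groups are torsion-free (Mathlib's
`IsMulTorsionFree (FreeGroup α)`). UNIQUENESS: if `P` has index `2` and is torsion-free then `a, b, c ∉ P` (they have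
order `2`), so the homomorphism `G → C₂`, `g ↦ [g ∉ P]` (a homomorphism by `Subgroup.mul_mem_iff_of_index_two`) agrees
with `Φ` on the generators, hence equals `Φ`, and `P = ker Φ`.

## Mathlib

USED: `Monoid.CoprodI.lift / of / ext_hom / of_injective`, `SemidirectProduct.lift / inl / inr / rightHom /
inl_aut / range_inl_eq_ker_rightHom`, `FreeGroup.lift / ext_hom`, `instIsMulTorsionFreeFreeGroup`
(`GroupTheory/FreeGroup/CyclicallyReduced`), `Subgroup.index_ker`, `Subgroup.mul_mem_iff_of_index_two`.
MISSING (proved here): homomorphisms out of `Multiplicative (ZMod 2)` (private helpers); the theorem itself.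
-/

noncomputable section

open Monoid

namespace Literature.GroupTheory.CombinatorialGroupTheory

/-! ### Homomorphisms out of the group of order two -/

/-- The two elements of `Multiplicative (ZMod 2)`. [folklore] -/
private theorem multiplicative_zmod_two_cases (t : (Multiplicative (ZMod 2))) : t = 1 ∨ t = Multiplicative.ofAdd 1 := by
  have h : ∀ z : ZMod 2, z = 0 ∨ z = 1 := by decide
  rcases h (Multiplicative.toAdd t) with h0 | h1
  · left
    exact (toAdd_eq_zero.mp h0)
  · right
    rw [← h1, ofAdd_toAdd]

/-- The non-trivial element of `Multiplicative (ZMod 2)` is not `1`. [folklore] -/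
private theorem ofAdd_one_ne_one : (Multiplicative.ofAdd (1 : ZMod 2)) ≠ 1 := by decide

/-- The non-trivial element of `Multiplicative (ZMod 2)` is an involution. [folklore] -/
private theorem ofAdd_one_mul_self : Multiplicative.ofAdd (1 : ZMod 2) * Multiplicative.ofAdd (1 : ZMod 2) = 1 := by
  decide

/-- Two monoid homomorphisms out of `Multiplicative (ZMod 2)` agreeing on the non-trivial element are equal.
[folklore] -/
private theorem monoidHom_zmod_two_ext {H : Type*} [Monoid H] {f g : (Multiplicative (ZMod 2)) →* H}
    (h : f (Multiplicative.ofAdd 1) = g (Multiplicative.ofAdd 1)) : f = g := by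
  refine MonoidHom.ext fun t => ?_
  rcases multiplicative_zmod_two_cases t with rfl | rfl
  · rw [map_one, map_one]
  · exact h

/-- Every involution `h` (`h * h = 1`) of a monoid is the image of the generator under a (unique) homomorphism
from the group of order two. [folklore] -/
private theorem exists_monoidHom_zmod_two {H : Type*} [Monoid H] (h : H) (hh : h * h = 1) :
    ∃ f : (Multiplicative (ZMod 2)) →* H, f (Multiplicative.ofAdd 1) = h := by
  classical
  refine ⟨{ toFun := fun t => if t = 1 then 1 else h, map_one' := if_pos rfl, map_mul' := ?_ }, ?_⟩
  · intro s t
    rcases multiplicative_zmod_two_cases s with rfl | rfl <;>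
      rcases multiplicative_zmod_two_cases t with rfl | rfl
    · simp
    · simp
    · simp
    · rw [ofAdd_one_mul_self, if_pos rfl, if_neg ofAdd_one_ne_one, hh]
  · show (if Multiplicative.ofAdd (1 : ZMod 2) = 1 then 1 else h) = h
    rw [if_neg ofAdd_one_ne_one]

/-! ### The theorem -/

/-- **`ℤ/2 ∗ ℤ/2 ∗ ℤ/2` has exactly one torsion-free subgroup of index two** — the group-theoretic content of «the
unique torsion-free subgroup of index two of the group `Π`» ([AbsTopII] Rmk 3.1.1) for the orbifold fundamental group
`Π ≅ ℤ/2 ∗ ℤ/2 ∗ ℤ/2` of the semi-elliptic hyperbolic core of type `(0; 2,2,2; ∞)`; it is the kernel of the sign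
homomorphism (identity on each factor), free of rank two. Typed verbatim as sub-node (a).1
`IndexTwoTorsionFreeUnique` of the [AbsTopIII] Cor. 2.7 sub-DAG.
[cite: MochizukiAbsTopIII2015, Corollary 2.7 (a) p.58] -/
theorem existsUnique_index_two_torsionFree :
    ∃! P : Subgroup (Monoid.CoprodI (fun _ : Fin 3 => Multiplicative (ZMod 2))),
      P.index = 2 ∧ ∀ g ∈ P, IsOfFinOrder g → g = 1 := by
  classical
  -- the generator of `(Multiplicative (ZMod 2))` and the three factor generators of `(Monoid.CoprodI (fun _ : Fin 3 => Multiplicative (ZMod 2)))`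
  set σ : (Multiplicative (ZMod 2)) := Multiplicative.ofAdd 1 with hσdef
  have hσσ : σ * σ = 1 := ofAdd_one_mul_self
  have hσ1 : σ ≠ 1 := ofAdd_one_ne_one
  set a : (Monoid.CoprodI (fun _ : Fin 3 => Multiplicative (ZMod 2))) := CoprodI.of (M := fun _ : Fin 3 => (Multiplicative (ZMod 2))) (i := 0) σ with hadef
  set b : (Monoid.CoprodI (fun _ : Fin 3 => Multiplicative (ZMod 2))) := CoprodI.of (M := fun _ : Fin 3 => (Multiplicative (ZMod 2))) (i := 1) σ with hbdef
  set c : (Monoid.CoprodI (fun _ : Fin 3 => Multiplicative (ZMod 2))) := CoprodI.of (M := fun _ : Fin 3 => (Multiplicative (ZMod 2))) (i := 2) σ with hcdef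
  have hof_sq : ∀ i : Fin 3, CoprodI.of (M := fun _ : Fin 3 => (Multiplicative (ZMod 2))) (i := i) σ * CoprodI.of (i := i) σ = 1 := by
    intro i
    rw [← map_mul, hσσ, map_one]
  have ha2 : a * a = 1 := hof_sq 0
  have hb2 : b * b = 1 := hof_sq 1
  have hc2 : c * c = 1 := hof_sq 2
  have hainv : a⁻¹ = a := inv_eq_of_mul_eq_one_right ha2
  have hbinv : b⁻¹ = b := inv_eq_of_mul_eq_one_right hb2
  have hcinv : c⁻¹ = c := inv_eq_of_mul_eq_one_right hc2
  -- the sign homomorphism `Φ`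
  set Φ : (Monoid.CoprodI (fun _ : Fin 3 => Multiplicative (ZMod 2))) →* (Multiplicative (ZMod 2)) := CoprodI.lift (fun _ : Fin 3 => MonoidHom.id (Multiplicative (ZMod 2))) with hΦdef
  have hΦof : ∀ (i : Fin 3) (t : (Multiplicative (ZMod 2))), Φ (CoprodI.of (M := fun _ : Fin 3 => (Multiplicative (ZMod 2))) (i := i) t) = t := by
    intro i t
    rw [hΦdef, CoprodI.lift_of]
    rfl
  have hindex : Φ.ker.index = 2 := by
    have hsurj : Function.Surjective Φ := by
      intro t
      rcases multiplicative_zmod_two_cases t with rfl | rfl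
      · exact ⟨1, map_one Φ⟩
      · exact ⟨a, hΦof 0 σ⟩
    rw [Subgroup.index_ker, MonoidHom.range_eq_top.mpr hsurj, Subgroup.card_top,
      Nat.card_congr (Multiplicative.toAdd : Multiplicative (ZMod 2) ≃ ZMod 2), Nat.card_zmod]
  -- the free group side: `ι` inverts both generators
  set ι : (FreeGroup (Fin 2)) →* (FreeGroup (Fin 2)) := FreeGroup.lift fun i => (FreeGroup.of i)⁻¹ with hιdef
  have hι_of : ∀ i, ι (FreeGroup.of i) = (FreeGroup.of i)⁻¹ := fun i => by
    rw [hιdef, FreeGroup.lift_apply_of]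
  have hιι : ∀ w, ι (ι w) = w := by
    have h : ι.comp ι = MonoidHom.id _ :=
      FreeGroup.ext_hom _ _ fun i => by simp [hι_of]
    intro w
    exact DFunLike.congr_fun h w
  set invAut : MulAut (FreeGroup (Fin 2)) := MulEquiv.mk ⟨ι, ι, hιι, hιι⟩ (map_mul ι) with hinvAutdef
  have hinvAut_apply : ∀ w, invAut w = ι w := fun _ => rfl
  have hinvAut_sq : invAut * invAut = 1 := by
    ext w
    rw [MulAut.mul_apply, hinvAut_apply, hinvAut_apply, hιι, MulAut.one_apply]
  obtain ⟨φ, hφ'⟩ := exists_monoidHom_zmod_two invAut hinvAut_sq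
  have hφ : φ σ = invAut := hφ'
  -- the semidirect product `(FreeGroup (Fin 2)) ⋊[φ] (Multiplicative (ZMod 2))` and the commutation rule `τ w = ι(w) τ`
  have hcomm : ∀ w : (FreeGroup (Fin 2)), (SemidirectProduct.inr σ : (FreeGroup (Fin 2)) ⋊[φ] (Multiplicative (ZMod 2))) * SemidirectProduct.inl w =
      SemidirectProduct.inl (ι w) * SemidirectProduct.inr σ := by
    intro w
    have h := SemidirectProduct.inl_aut (φ := φ) σ w
    rw [hφ, hinvAut_apply] at h
    rw [h, mul_assoc, ← map_mul, inv_eq_of_mul_eq_one_right hσσ, hσσ, map_one, mul_one]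
  set x : (FreeGroup (Fin 2)) := FreeGroup.of 0 with hxdef
  set y : (FreeGroup (Fin 2)) := FreeGroup.of 1 with hydef
  set A : (FreeGroup (Fin 2)) ⋊[φ] (Multiplicative (ZMod 2)) := SemidirectProduct.inr σ with hAdef
  set B : (FreeGroup (Fin 2)) ⋊[φ] (Multiplicative (ZMod 2)) := SemidirectProduct.inl x * SemidirectProduct.inr σ with hBdef
  set C : (FreeGroup (Fin 2)) ⋊[φ] (Multiplicative (ZMod 2)) := SemidirectProduct.inl y * SemidirectProduct.inr σ with hCdef
  have hAA : A * A = 1 := by rw [hAdef, ← map_mul, hσσ, map_one]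
  have hinvol : ∀ w : (FreeGroup (Fin 2)), ι w = w⁻¹ →
      (SemidirectProduct.inl w * SemidirectProduct.inr σ : (FreeGroup (Fin 2)) ⋊[φ] (Multiplicative (ZMod 2))) *
        (SemidirectProduct.inl w * SemidirectProduct.inr σ) = 1 := by
    intro w hw
    calc (SemidirectProduct.inl w * SemidirectProduct.inr σ : (FreeGroup (Fin 2)) ⋊[φ] (Multiplicative (ZMod 2))) *
          (SemidirectProduct.inl w * SemidirectProduct.inr σ)
        = SemidirectProduct.inl w * (SemidirectProduct.inr σ * SemidirectProduct.inl w) *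
            SemidirectProduct.inr σ := by simp only [mul_assoc]
      _ = SemidirectProduct.inl w * (SemidirectProduct.inl (ι w) * SemidirectProduct.inr σ) *
            SemidirectProduct.inr σ := by rw [hcomm]
      _ = SemidirectProduct.inl (w * ι w) * (SemidirectProduct.inr (σ * σ)) := by
            rw [map_mul, map_mul]; simp only [mul_assoc]
      _ = 1 := by rw [hw, mul_inv_cancel, hσσ, map_one, map_one, mul_one]
  have hBB : B * B = 1 := hinvol x (hι_of 0)
  have hCC : C * C = 1 := hinvol y (hι_of 1)
  obtain ⟨fA, hfA⟩ := exists_monoidHom_zmod_two A hAA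
  obtain ⟨fB, hfB⟩ := exists_monoidHom_zmod_two B hBB
  obtain ⟨fC, hfC⟩ := exists_monoidHom_zmod_two C hCC
  -- `ψ : (Monoid.CoprodI (fun _ : Fin 3 => Multiplicative (ZMod 2))) → (FreeGroup (Fin 2)) ⋊ (Multiplicative (ZMod 2))`
  set ψ : (Monoid.CoprodI (fun _ : Fin 3 => Multiplicative (ZMod 2))) →* (FreeGroup (Fin 2)) ⋊[φ] (Multiplicative (ZMod 2)) := CoprodI.lift (M := fun _ : Fin 3 => (Multiplicative (ZMod 2))) ![fA, fB, fC] with hψdef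
  have hψa : ψ a = A := by rw [hadef, hψdef, CoprodI.lift_of]; exact hfA
  have hψb : ψ b = B := by rw [hbdef, hψdef, CoprodI.lift_of]; exact hfB
  have hψc : ψ c = C := by rw [hcdef, hψdef, CoprodI.lift_of]; exact hfC
  -- `Θ : (FreeGroup (Fin 2)) ⋊ (Multiplicative (ZMod 2)) → (Monoid.CoprodI (fun _ : Fin 3 => Multiplicative (ZMod 2)))`
  set θ₁ : (FreeGroup (Fin 2)) →* (Monoid.CoprodI (fun _ : Fin 3 => Multiplicative (ZMod 2))) := FreeGroup.lift ![b * a, c * a] with hθ₁def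
  have hθ₁x : θ₁ x = b * a := by rw [hxdef, hθ₁def, FreeGroup.lift_apply_of]; rfl
  have hθ₁y : θ₁ y = c * a := by rw [hydef, hθ₁def, FreeGroup.lift_apply_of]; rfl
  obtain ⟨θ₂, hθ₂'⟩ := exists_monoidHom_zmod_two a ha2
  have hθ₂ : θ₂ σ = a := hθ₂'
  have hv : ∀ i : Fin 2, ∃ g : (Monoid.CoprodI (fun _ : Fin 3 => Multiplicative (ZMod 2))), g * g = 1 ∧ (![b * a, c * a] : Fin 2 → (Monoid.CoprodI (fun _ : Fin 3 => Multiplicative (ZMod 2)))) i = g * a := by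
    intro i
    fin_cases i
    · exact ⟨b, hb2, by simp⟩
    · exact ⟨c, hc2, by simp⟩
  have hcompat : ∀ g : (Multiplicative (ZMod 2)), θ₁.comp (φ g).toMonoidHom = (MulAut.conj (θ₂ g)).toMonoidHom.comp θ₁ := by
    intro g
    rcases multiplicative_zmod_two_cases g with rfl | rfl
    · apply FreeGroup.ext_hom
      intro i
      simp
    · apply FreeGroup.ext_hom
      intro i
      change θ₁ ((φ σ) (FreeGroup.of i)) = θ₂ σ * θ₁ (FreeGroup.of i) * (θ₂ σ)⁻¹
      obtain ⟨g, hg2, hgi⟩ := hv i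
      rw [hφ, hinvAut_apply, hι_of, map_inv, hθ₂, hainv, hθ₁def, FreeGroup.lift_apply_of, hgi, mul_inv_rev,
        hainv, inv_eq_of_mul_eq_one_right hg2, mul_assoc a (g * a) a, mul_assoc g a a, ha2, mul_one]
  set Θ : (FreeGroup (Fin 2)) ⋊[φ] (Multiplicative (ZMod 2)) →* (Monoid.CoprodI (fun _ : Fin 3 => Multiplicative (ZMod 2))) := SemidirectProduct.lift θ₁ θ₂ hcompat with hΘdef
  have hΘA : Θ A = a := by rw [hAdef, hΘdef, SemidirectProduct.lift_inr, hθ₂]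
  have hΘB : Θ B = b := by
    rw [hBdef, map_mul, hΘdef, SemidirectProduct.lift_inl, SemidirectProduct.lift_inr, hθ₂, hθ₁x, mul_assoc,
      ha2, mul_one]
  have hΘC : Θ C = c := by
    rw [hCdef, map_mul, hΘdef, SemidirectProduct.lift_inl, SemidirectProduct.lift_inr, hθ₂, hθ₁y, mul_assoc,
      ha2, mul_one]
  -- `Θ ∘ ψ = id`, so `ψ` is injective
  have hΘψ : Θ.comp ψ = MonoidHom.id (Monoid.CoprodI (fun _ : Fin 3 => Multiplicative (ZMod 2))) := by
    refine CoprodI.ext_hom _ _ fun i => monoidHom_zmod_two_ext ?_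
    fin_cases i
    · show Θ (ψ a) = a
      rw [hψa, hΘA]
    · show Θ (ψ b) = b
      rw [hψb, hΘB]
    · show Θ (ψ c) = c
      rw [hψc, hΘC]
  have hleft : ∀ g : (Monoid.CoprodI (fun _ : Fin 3 => Multiplicative (ZMod 2))), Θ (ψ g) = g := fun g => DFunLike.congr_fun hΘψ g
  -- `rightHom ∘ ψ = Φ`
  have hright : (SemidirectProduct.rightHom (φ := φ)).comp ψ = Φ := by
    refine CoprodI.ext_hom _ _ fun i => monoidHom_zmod_two_ext ?_
    fin_cases i
    · show SemidirectProduct.rightHom (ψ a) = Φ a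
      rw [hψa, hAdef, SemidirectProduct.rightHom_inr, hadef, hΦof]
    · show SemidirectProduct.rightHom (ψ b) = Φ b
      rw [hψb, hBdef, map_mul, SemidirectProduct.rightHom_inl, SemidirectProduct.rightHom_inr, one_mul, hbdef, hΦof]
    · show SemidirectProduct.rightHom (ψ c) = Φ c
      rw [hψc, hCdef, map_mul, SemidirectProduct.rightHom_inl, SemidirectProduct.rightHom_inr, one_mul, hcdef, hΦof]
  -- EXISTENCE: `ker Φ` is torsion-free
  have htf : ∀ g ∈ Φ.ker, IsOfFinOrder g → g = 1 := by
    intro g hg hfin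
    have h1 : SemidirectProduct.rightHom (ψ g) = 1 := by
      rw [← MonoidHom.comp_apply, hright]
      exact hg
    have h2 : ψ g ∈ (SemidirectProduct.inl (φ := φ)).range := by
      rw [SemidirectProduct.range_inl_eq_ker_rightHom]
      exact h1
    obtain ⟨w, hw⟩ := h2
    have hwfin : IsOfFinOrder w := by
      rw [← (SemidirectProduct.inl_injective (N := (FreeGroup (Fin 2))) (G := (Multiplicative (ZMod 2))) (φ := φ)).isOfFinOrder_iff, hw]
      exact ψ.isOfFinOrder hfin
    obtain ⟨n, hn, hwn⟩ := hwfin.exists_pow_eq_one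
    have hw1 : w = 1 :=
      IsMulTorsionFree.pow_left_injective hn.ne' (by simpa using hwn : w ^ n = 1 ^ n)
    have hψg : ψ g = 1 := by rw [← hw, hw1, map_one]
    rw [← hleft g, hψg, map_one]
  refine ⟨Φ.ker, ⟨hindex, htf⟩, ?_⟩
  -- UNIQUENESS
  rintro P ⟨hP2, hPtf⟩
  have hnot : ∀ i : Fin 3, (CoprodI.of (M := fun _ : Fin 3 => (Multiplicative (ZMod 2))) (i := i) σ : (Monoid.CoprodI (fun _ : Fin 3 => Multiplicative (ZMod 2)))) ∉ P := by
    intro i hi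
    have hfin : IsOfFinOrder (CoprodI.of (M := fun _ : Fin 3 => (Multiplicative (ZMod 2))) (i := i) σ : (Monoid.CoprodI (fun _ : Fin 3 => Multiplicative (ZMod 2)))) :=
      isOfFinOrder_iff_pow_eq_one.mpr ⟨2, two_pos, by rw [pow_two, hof_sq i]⟩
    have h1 : (CoprodI.of (M := fun _ : Fin 3 => (Multiplicative (ZMod 2))) (i := i) σ : (Monoid.CoprodI (fun _ : Fin 3 => Multiplicative (ZMod 2)))) = 1 := hPtf _ hi hfin
    have : σ = 1 := CoprodI.of_injective i (h1.trans (map_one _).symm)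
    exact hσ1 this
  -- the homomorphism `g ↦ [g ∉ P]` with kernel `P`
  let Φ' : (Monoid.CoprodI (fun _ : Fin 3 => Multiplicative (ZMod 2))) →* (Multiplicative (ZMod 2)) :=
    { toFun := fun g => if g ∈ P then 1 else σ
      map_one' := if_pos P.one_mem
      map_mul' := by
        intro g h
        have key := Subgroup.mul_mem_iff_of_index_two hP2 (a := g) (b := h)
        by_cases hg : g ∈ P <;> by_cases hh : h ∈ P
        · rw [if_pos (key.mpr (iff_of_true hg hh)), if_pos hg, if_pos hh, one_mul]
        · rw [if_neg (fun hgh => hh ((key.mp hgh).mp hg)), if_pos hg, if_neg hh, one_mul]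
        · rw [if_neg (fun hgh => hg ((key.mp hgh).mpr hh)), if_neg hg, if_pos hh, mul_one]
        · rw [if_pos (key.mpr (iff_of_false hg hh)), if_neg hg, if_neg hh, hσσ] }
  have hΦ'apply : ∀ g : (Monoid.CoprodI (fun _ : Fin 3 => Multiplicative (ZMod 2))), Φ' g = if g ∈ P then 1 else σ := fun _ => rfl
  have hΦ'Φ : Φ' = Φ := by
    refine CoprodI.ext_hom _ _ fun i => monoidHom_zmod_two_ext ?_
    show Φ' (CoprodI.of (M := fun _ : Fin 3 => (Multiplicative (ZMod 2))) (i := i) σ) = Φ (CoprodI.of (M := fun _ : Fin 3 => (Multiplicative (ZMod 2))) (i := i) σ)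
    rw [hΦ'apply, if_neg (hnot i), hΦof]
  ext g
  rw [MonoidHom.mem_ker, ← hΦ'Φ, hΦ'apply]
  by_cases hg : g ∈ P
  · simp [hg]
  · simp [hg, hσ1]

end Literature.GroupTheory.CombinatorialGroupTheory
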